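import Summits.Schanuel.Schanuel.Theorems.ZilberEacRealLineTiltedWindows
import Summits.Schanuel.Schanuel.Theorems.ZilberEacFibreCurveZerosEdge
import HarnessLib

/-!
# Non-split surfaces over a line of REAL IRRATIONAL slope, V: zeros along a tilted edge with
# two-sided fibre asymptotics; weight bookkeeping

HONEST FRAMING.  Cell `pub-schanuel` (Zilber's Exponential-Algebraic Closedness, case ladder;
host summit Schanuel), seat 2, gen 18 (HANDOFF O68 (a)).  From `exists_zero_at_far_tilted_window`:
zeros `z_k = ζ_k + μ log(2πn_k) + 2πin_k` of `P(z; e^z, e^{az+b})` with `n_k → ∞`, `|ζ_k - x₀| < 1`,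
hence `T_k := log(2πn_k) → ∞`, `|log|z_k| - T_k| ≤ 1` eventually (`tendsto_log_sub_log_of_abs_sub_le`)
and `|Re z_k - μT_k| ≤ |x₀| + 1` — so `log|e^{z_k}| = μT_k + O(1)`, `log|e^{az_k+b}| = aμT_k + O(1)`
(`exists_lineSurface_tilted_zeros`).  Bookkeeping: weights `(1, γ)` with `γ ∉ ℚ` are injective on
`ℕ²` (`injOn_weight_of_irrational`); distinct `y`-exponents have distinct weights `d₁ + ad₂`
(`weight_ne_of_tail_ne`); torus fibres over infinitely many base points force two distinct
`y`-exponents (`exists_tail_ne_of_infinite_torusFibres`).  Density: `ZilberEacRealLineSurfaceAll`.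
NOT Schanuel's conjecture (neither used nor implied; EAC ⇏ SC); `EC(3,2)` stays OPEN.
-/

noncomputable section

open Filter Topology Metric Set Complex MvPolynomial
open Literature.NumberTheory.Transcendental Literature.ModelTheory.Zilber
open Literature.ModelTheory.ExponentialFields

set_option linter.dupNamespace false

namespace Summit.Schanuel.Schanuel.Theorems

/-! ## Part A. Zeros in tilted windows with two-sided fibre asymptotics -/

section Zeros

variable {a : ℝ} (b : ℂ) (P : MvPolynomial (Fin 3) ℂ)

/-- **Zeros of `P(z; e^z, e^{az+b})` along a tilted edge, with asymptotics.**  Under the hypotheses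
of `exists_zero_at_far_tilted_window` there are zeros `z_k` and `T_k → ∞` (`T_k = log(2πn_k)`)
with `|log|z_k| - T_k| ≤ 1` eventually and `|Re z_k - μT_k| ≤ |x₀| + 1`. (new) -/
theorem exists_lineSurface_tilted_zeros (ha : Irrational a) (μ κ : ℝ)
    (hκ : ∀ d ∈ P.support, ((d 0 : ℕ) : ℝ) + μ * ((d 1 : ℕ) + a * (d 2 : ℕ)) ≤ κ)
    {u₀ x₀ : ℂ} (hu₀ : ‖u₀‖ = 1)
    (hne : ∃ z, curveFn a b (∑ d ∈ P.support.filter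
        (fun d : Fin 3 →₀ ℕ => ((d 0 : ℕ) : ℝ) + μ * ((d 1 : ℕ) + a * (d 2 : ℕ)) = κ),
        monomial (Finsupp.tail d) (P.coeff d * I ^ (d 0))) u₀ z ≠ 0)
    (hx₀ : curveFn a b (∑ d ∈ P.support.filter
        (fun d : Fin 3 →₀ ℕ => ((d 0 : ℕ) : ℝ) + μ * ((d 1 : ℕ) + a * (d 2 : ℕ)) = κ),
        monomial (Finsupp.tail d) (P.coeff d * I ^ (d 0))) u₀ x₀ = 0) :
    ∃ (z : ℕ → ℂ) (T : ℕ → ℝ), Tendsto T atTop atTop ∧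
      (∀ k, MvPolynomial.eval (Fin.cons (z k) (rfPt a b 1 (z k)) : Fin 3 → ℂ) P = 0) ∧
      Tendsto (fun k => ‖z k‖) atTop atTop ∧
      (∀ᶠ k in atTop, |Real.log ‖z k‖ - T k| ≤ 1) ∧
      (∀ k, |(z k).re - μ * T k| ≤ ‖x₀‖ + 1) := by
  have key : ∀ k : ℕ, ∃ (n : ℕ) (ζ : ℂ), k ≤ n ∧ 1 ≤ n ∧ ‖ζ - x₀‖ < 1 ∧
      MvPolynomial.eval (Fin.cons (ζ + μ * Real.log (2 * Real.pi * n) + n * (2 * Real.pi * I))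
        (rfPt a b 1 (ζ + μ * Real.log (2 * Real.pi * n) + n * (2 * Real.pi * I))) : Fin 3 → ℂ) P = 0 := by
    intro k
    obtain ⟨n, ζ, hn, hn1, -, hζ, h0⟩ :=
      exists_zero_at_far_tilted_window ha b P μ κ hκ hu₀ hne hx₀ one_pos k
    exact ⟨n, ζ, hn, hn1, hζ, h0⟩
  choose n ζ hn hn1 hζ hzero using key
  set T : ℕ → ℝ := fun k => Real.log (2 * Real.pi * n k) with hT
  set z : ℕ → ℂ := fun k => ζ k + μ * Real.log (2 * Real.pi * n k) + n k * (2 * Real.pi * I) with hz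
  have hN : Tendsto (fun k => (2 * Real.pi * (n k : ℝ))) atTop atTop :=
    (tendsto_natCast_atTop_atTop.comp (tendsto_atTop_mono hn tendsto_id)).const_mul_atTop
      Real.two_pi_pos
  have hT_t : Tendsto T atTop atTop := Real.tendsto_log_atTop.comp hN
  have hζb : ∀ k, ‖ζ k‖ ≤ ‖x₀‖ + 1 := fun k => by
    have := norm_add_le (ζ k - x₀) x₀; rw [sub_add_cancel] at this; linarith [hζ k]
  have hre : ∀ k, (z k).re = (ζ k).re + μ * T k := by
    intro k
    simp only [hz, hT, Complex.add_re, Complex.mul_re, Complex.mul_im, Complex.ofReal_re,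
      Complex.ofReal_im, Complex.natCast_re, Complex.natCast_im, Complex.I_re, Complex.I_im,
      Complex.re_ofNat, Complex.im_ofNat]
    ring
  -- distance of `‖z_k‖` to `2πn_k`
  have hdiff : ∀ k, |2 * Real.pi * (n k : ℝ) - ‖z k‖| ≤ (‖x₀‖ + 1) + |μ| * Real.log (2 * Real.pi * n k) := by
    intro k
    have hc : ‖(n k : ℂ) * (2 * Real.pi * I)‖ = 2 * Real.pi * n k := by
      rw [norm_mul, Complex.norm_natCast]; simp [abs_of_pos Real.pi_pos]; ring
    have hL0 : 0 ≤ Real.log (2 * Real.pi * n k) := by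
      refine Real.log_nonneg ?_
      have : (1 : ℝ) ≤ n k := by exact_mod_cast hn1 k
      have := Real.pi_gt_three; nlinarith
    have hw : ‖ζ k + (μ : ℂ) * (Real.log (2 * Real.pi * n k) : ℝ)‖ ≤ (‖x₀‖ + 1) + |μ| * Real.log (2 * Real.pi * n k) := by
      refine (norm_add_le _ _).trans (add_le_add (hζb k) ?_)
      rw [norm_mul, Complex.norm_real, Complex.norm_real, Real.norm_eq_abs, Real.norm_eq_abs,
        abs_of_nonneg hL0]
    have e : z k = (ζ k + (μ : ℂ) * (Real.log (2 * Real.pi * n k) : ℝ)) + (n k : ℂ) * (2 * Real.pi * I) := by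
      simp only [hz]
    rw [abs_sub_comm, abs_le]
    constructor
    · have h1 := norm_le_norm_add_norm_sub' (z k) ((n k : ℂ) * (2 * Real.pi * I))
      -- ‖z‖ ≥ ‖c‖ - ‖z - c‖
      have h2 : ‖(n k : ℂ) * (2 * Real.pi * I)‖ - ‖z k - (n k : ℂ) * (2 * Real.pi * I)‖ ≤ ‖z k‖ := by
        have := norm_sub_norm_le ((n k : ℂ) * (2 * Real.pi * I)) (z k)
        rw [norm_sub_rev] at this; linarith
      have h3 : z k - (n k : ℂ) * (2 * Real.pi * I) = ζ k + (μ : ℂ) * (Real.log (2 * Real.pi * n k) : ℝ) := by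
        rw [e]; ring
      rw [h3, hc] at h2
      linarith
    · have h2 : ‖z k‖ ≤ ‖ζ k + (μ : ℂ) * (Real.log (2 * Real.pi * n k) : ℝ)‖ + ‖(n k : ℂ) * (2 * Real.pi * I)‖ := by
        rw [e]; exact norm_add_le _ _
      rw [hc] at h2
      linarith
  have hnorm_t : Tendsto (fun k => ‖z k‖) atTop atTop := by
    have h := tendsto_sub_log_affine (N := fun k => (n k : ℝ))
      (tendsto_natCast_atTop_atTop.comp (tendsto_atTop_mono hn tendsto_id)) |μ| 0 (‖x₀‖ + 1)
      (abs_nonneg μ) le_rfl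
    refine tendsto_atTop_mono (fun k => ?_) h
    have := hdiff k
    rw [abs_le] at this
    simp only [add_zero]
    linarith [this.2]
  have hlog : Tendsto (fun k => Real.log ‖z k‖ - Real.log (2 * Real.pi * (n k : ℝ))) atTop (𝓝 0) :=
    tendsto_log_sub_log_of_abs_sub_le hN (C := ‖x₀‖ + 1) (D := |μ|)
      (Filter.Eventually.of_forall hdiff)
  refine ⟨z, T, hT_t, hzero, hnorm_t, ?_, fun k => ?_⟩
  · have := (Metric.tendsto_nhds.1 hlog) 1 one_pos
    filter_upwards [this] with k hk
    rw [Real.dist_eq, sub_zero] at hk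
    exact hk.le
  · rw [hre k, add_sub_cancel_right]
    exact (abs_re_le_norm _).trans (hζb k)

end Zeros

/-! ## Part B. Weight bookkeeping -/

section Weights

variable {a : ℝ} {P : MvPolynomial (Fin 3) ℂ}

/-- Weights `d ↦ d₀ + γ d₁` with `γ ∉ ℚ` are injective on `ℕ²`. [folklore] -/
theorem injOn_weight_of_irrational {γ : ℝ} (hγ : Irrational γ) (S : Set (Fin 2 →₀ ℕ)) :
    Set.InjOn (fun d : Fin 2 →₀ ℕ => ∑ i, (d i : ℝ) * (![1, γ] : Fin 2 → ℝ) i) S := by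
  intro d _ d' _ h
  simp only [Fin.sum_univ_two, Matrix.cons_val_zero, Matrix.cons_val_one, mul_one] at h
  have h1 : d 1 = d' 1 := by
    by_contra hne
    have hne' : ((d 1 : ℝ) - d' 1) ≠ 0 := by
      rw [sub_ne_zero]; exact_mod_cast hne
    have hneZ : (d 1 : ℤ) ≠ d' 1 := by exact_mod_cast hne
    refine (irrational_iff_ne_rational γ).1 hγ ((d' 0 : ℤ) - d 0) ((d 1 : ℤ) - d' 1)
      (sub_ne_zero.2 hneZ) ?_
    push_cast
    rw [eq_div_iff hne']
    linarith
  have h0 : d 0 = d' 0 := by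
    rw [h1] at h
    have : (d 0 : ℝ) = d' 0 := by linarith
    exact_mod_cast this
  ext i; fin_cases i; exacts [h0, h1]

/-- Distinct `y`-exponents have distinct weights `d₁ + a d₂` (`a ∉ ℚ`). [folklore] -/
theorem weight_ne_of_tail_ne (ha : Irrational a) {d d' : Fin 3 →₀ ℕ}
    (h : Finsupp.tail d ≠ Finsupp.tail d') :
    ((d 1 : ℕ) : ℝ) + a * (d 2 : ℕ) ≠ (d' 1 : ℕ) + a * (d' 2 : ℕ) := by
  intro heq
  apply h
  have h2 : d 2 = d' 2 := by
    by_contra hne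
    have hne' : ((d 2 : ℝ) - d' 2) ≠ 0 := by rw [sub_ne_zero]; exact_mod_cast hne
    have hneZ : (d 2 : ℤ) ≠ d' 2 := by exact_mod_cast hne
    refine (irrational_iff_ne_rational a).1 ha ((d' 1 : ℤ) - d 1) ((d 2 : ℤ) - d' 2)
      (sub_ne_zero.2 hneZ) ?_
    push_cast
    rw [eq_div_iff hne']
    linarith
  have h1 : d 1 = d' 1 := by
    rw [h2] at heq
    have : (d 1 : ℝ) = d' 1 := by linarith
    exact_mod_cast this
  ext i
  fin_cases i
  · simpa [Finsupp.tail_apply] using h1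
  · simpa [Finsupp.tail_apply] using h2

/-- Torus fibres over infinitely many base points force two monomials of different
`(y₀, y₁)`-exponent (else `P = y^m Q(x)` and the fibres lie over the roots of `Q`). [folklore] -/
theorem exists_tail_ne_of_infinite_torusFibres (hP : P ≠ 0)
    (hfib : Set.Infinite {t : ℂ | ∃ c : Fin 2 → ℂ, c 0 ≠ 0 ∧ c 1 ≠ 0 ∧
      MvPolynomial.eval ![t, c 0, c 1] P = 0}) :
    ∃ d ∈ P.support, ∃ d' ∈ P.support, Finsupp.tail d ≠ Finsupp.tail d' := by
  classical
  by_contra hall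
  push Not at hall
  obtain ⟨d₀, hd₀⟩ := MvPolynomial.ne_zero_iff.1 hP
  have hd₀s : d₀ ∈ P.support := MvPolynomial.mem_support_iff.2 hd₀
  set m := Finsupp.tail d₀ with hm
  have htail : ∀ d ∈ P.support, Finsupp.tail d = m := fun d hd => hall d hd d₀ hd₀s
  -- the univariate polynomial `Q(x) = Σ_d c_d x^{d₀}`
  set Q : Polynomial ℂ := ∑ d ∈ P.support, Polynomial.C (P.coeff d) * Polynomial.X ^ (d 0) with hQ
  have hinj : ∀ d ∈ P.support, ∀ d' ∈ P.support, d 0 = d' 0 → d = d' := by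
    intro d hd d' hd' h0
    have ht := (htail d hd).trans (htail d' hd').symm
    have h1 : d 1 = d' 1 := by simpa [Finsupp.tail_apply] using DFunLike.congr_fun ht 0
    have h2 : d 2 = d' 2 := by simpa [Finsupp.tail_apply] using DFunLike.congr_fun ht 1
    ext i; fin_cases i; exacts [h0, h1, h2]
  have hQcoeff : Q.coeff (d₀ 0) = P.coeff d₀ := by
    rw [hQ, Polynomial.finsetSum_coeff, Finset.sum_eq_single d₀]
    · rw [Polynomial.coeff_C_mul, Polynomial.coeff_X_pow, if_pos rfl, mul_one]
    · intro d hd hne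
      rw [Polynomial.coeff_C_mul, Polynomial.coeff_X_pow, if_neg, mul_zero]
      exact fun h => hne (hinj d hd d₀ hd₀s h.symm)
    · intro h; exact (h hd₀s).elim
  have hQ0 : Q ≠ 0 := fun h => hd₀ (by rw [← hQcoeff, h, Polynomial.coeff_zero])
  -- every torus fibre lies over a root of `Q`
  have heval : ∀ (t : ℂ) (c : Fin 2 → ℂ), MvPolynomial.eval ![t, c 0, c 1] P =
      c 0 ^ (m 0) * c 1 ^ (m 1) * Q.eval t := by
    intro t c
    rw [MvPolynomial.eval_eq', hQ, Polynomial.eval_finsetSum, Finset.mul_sum]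
    refine Finset.sum_congr rfl fun d hd => ?_
    rw [Fin.prod_univ_three, Polynomial.eval_mul, Polynomial.eval_C, Polynomial.eval_pow,
      Polynomial.eval_X]
    have h1 : d 1 = m 0 := by rw [← htail d hd]; simp [Finsupp.tail_apply]
    have h2 : d 2 = m 1 := by rw [← htail d hd]; simp [Finsupp.tail_apply]
    simp only [Matrix.cons_val_zero, Matrix.cons_val_one, Matrix.cons_val, h1, h2]
    ring
  refine hfib ((Q.roots.toFinset.finite_toSet).subset ?_)
  rintro t ⟨c, hc0, hc1, hc⟩
  rw [heval] at hc
  have hQt : Q.eval t = 0 := by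
    rcases mul_eq_zero.1 hc with h | h
    · exfalso
      exact (mul_ne_zero (pow_ne_zero _ hc0) (pow_ne_zero _ hc1)) h
    · exact h
  simp only [Finset.mem_coe, Multiset.mem_toFinset]
  exact (Polynomial.mem_roots hQ0).2 hQt

end Weights

end Summit.Schanuel.Schanuel.Theorems
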